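import Summits.QuantumFields.BalabanUV.T4Continuum.Spine.NE1p.TiltedMeanInfluence
import Mathlib.MeasureTheory.Function.ConditionalExpectation.CondJensen

/-!
# BalabanUVNodes ∕ node N14 = NE1′ — THE VARIANCE SOCKET of the residual `TiltedMeanMatching` (:253) and the ESTIMATE-FREE
# reverse-martingale identities behind a variance ledger (LENS control, cards 3 and 2)

Cell `pub-ymgap`, HUMAN RULING D-0062 (Track A at full width), seat `pub-ymgap-dag-n14-c` (R134 ACCELERATION, strategy s1), generation 3;
route `Summits/QuantumFields/YangMills/Theses/BalabanUVNodes.lean` (cluster K3, `--supports`); venue ruling R424 (`YangMills/Theorems`,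
namespace `YMDAG.N14.VarianceSocket`).  SPEC: the lens seat `ym-lens-BalabanUVNodes-control` (memo `LENS-control.md` bdbc715bd5c6066f, sorried
sketch `Sketch-control.lean` fc135459a54a09aa, cards 3 and 2) — this file lands its signatures C3-a, C2-a, C2-b, C2-c SORRY-FREE.  ADDITIVE —
imports the gaps-ne1 module `Spine/NE1p/TiltedMeanInfluence` (p345179-lineage: `hasDerivAt_tiltedMean`, hence `DressedMGFForm.tiltedMean` ∕
`TiltedMeanMatching` ∕ `MGFForm`) and Mathlib's conditional Jensen file ONLY; theorems only; modifies nothing.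

WHAT THIS IS.
* §1 **THE VARIANCE SOCKET** (`tiltedMeanMatching_of_variance`, card 3 C3-a).  The residual binder of N14's integrated currency,
  `DressedMGFForm.TiltedMeanMatching l₀ T Bad F ν F′ ν′ η` (:253: on every good class the two runs' source-tilted history-conditioned
  first moments agree within `η K` for all tilts `|s| ≤ l₀`), follows from ZERO-TILT mean matching `η₀ K` plus tilted-VARIANCE matching
  `ηᵥ K` on the tilt window, with `η K = η₀ K + l₀·ηᵥ K`: the tilt-derivative of the tilted mean IS the tilted variance
  (`TiltedMeanInfluence.hasDerivAt_tiltedMean`, fluctuation–response), so the mean value inequality for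
  `s ↦ tiltedMean F′ ν′ s − tiltedMean F ν s` on `[−l₀, l₀]` does it (`abs_tiltedMean_sub_sub_le`, one class; `…_of_mgfForm`, the
  `MGFForm`-keyed reading).  Record R23 of `pub-balaban-gaps/ne/NE1.md` («matching tilted variances is (c) in disguise») used FORWARD.
* §2 **REVERSE-MARTINGALE ENERGY IDENTITY** (`energy_identity_antitone`, card 2 C2-a).  For a finite measure `μ`, an ANTITONE family
  `𝒢 : ℕ → MeasurableSpace Ω` of sub-σ-algebras and `Φ ∈ L²(μ)`, the increments of `N k = μ[Φ | 𝒢 k]` are orthogonal and their energies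
  telescope: `Σ_{k<K} ∫(N k − N (k+1))² = ∫(N 0)² − ∫(N K)²` — K-uniform, estimate-free (tower `condExp_condExp_of_le` + pull-out).  With the
  history-extended RG chain's «present-and-future» σ-algebras this is the ANOVA of the class variance along the scales (card 3 (ii)) and the
  energy bookkeeping of the dressed weight `E[e^{tF₀} | 𝒢 k]` (card 2 (iii)).  `sum_abs_increment_cov_le` (C2-c) is its polarised form: the
  total increment–increment interaction of two such martingales is bounded by half the sum of the two initial energies.
* §3 **JENSEN GAP OF THE LOGARITHM** (`condExp_log_gap_le`, card 2 C2-b).  For `N ∈ [a, b]`, `a > 0`, and a sub-σ-algebra `m`: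
  `log(μ[N|m]) − μ[log N | m] ≤ μ[(N − μ[N|m])² | m] ∕ (2a²)` a.e. — Mathlib's conditional Jensen (`ConvexOn.map_condExp_le`) for the
  CONVEX function `y ↦ log y + y²∕(2a²)` on `[a, b]` (its second derivative is `a⁻² − y⁻² ≥ 0` there), plus the pull-out identity
  `μ[(N − μ[N|m])² | m] = μ[N² | m] − (μ[N|m])²`: pathwise, the born term of one step is SECOND order in the martingale increment.

WHAT THIS IS NOT.  Consumer-side glue and [folklore] identities of probability (mean value inequality, `L²` orthogonality of martingale
increments, conditional Jensen); NOTHING of Bałaban's is asserted or instantiated: which tilted class laws, which history chain and which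
variance matching `ηᵥ` hold for the runs of record is NODE O's OBJECT (`RRec₁₁ 𝔯 𝔱` keeps the ne1 assignment residual); the socket costs a
factor `l₀` and needs `η₀` separately (zero-tilt matching is NOT implied by variance matching — NE1.md R23 (a)).  N14 NOT discharged; K3 and
`TiltedMeanMatching` NOT instantiated; count-neutral.  One finite four-torus programme at fixed ε; NOT ℝ⁴, NOT OS, NOT a mass gap, NOT Clay.
0 sorry.
-/

noncomputable section

namespace YMDAG.N14.VarianceSocket

open MeasureTheory ProbabilityTheory Finset
open scoped ENNReal
open Summit.QuantumFields.BalabanUV.T4Continuum.NE1p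
open Summit.QuantumFields.BalabanUV.T4Continuum.NE1p.DressedMGFForm (tiltedMean TiltedMeanMatching MGFForm)
open Summit.QuantumFields.BalabanUV.T4Continuum.NE1p.TiltedMeanInfluence (hasDerivAt_tiltedMean)

/-! ## §1 The variance socket: zero-tilt means + tilted variances ⇒ `TiltedMeanMatching` -/

section Socket

/-- **ONE CLASS, TWO TERMS** [folklore].  `ν₁`, `ν₂` finite, `G₁`, `G₂` measurable with `|Gᵢ| ≤ B`.  If the tilted VARIANCES differ by
at most `ηᵥ` for every tilt `|x| ≤ l₀`, then for `|s| ≤ l₀` the difference of the tilted MEANS moves by at most `ηᵥ·|s|` between tilt `0`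
and tilt `s`: the mean value inequality for `x ↦ tiltedMean G₂ ν₂ x − tiltedMean G₁ ν₁ x`, whose derivative is the difference of the
tilted variances (`TiltedMeanInfluence.hasDerivAt_tiltedMean`). -/
theorem abs_tiltedMean_sub_sub_le {Ω₁ Ω₂ : Type*} {m₁ : MeasurableSpace Ω₁} {m₂ : MeasurableSpace Ω₂} {ν₁ : Measure Ω₁}
    {ν₂ : Measure Ω₂} [IsFiniteMeasure ν₁] [IsFiniteMeasure ν₂] {G₁ : Ω₁ → ℝ} {G₂ : Ω₂ → ℝ} {B : ℝ}
    (h1m : Measurable G₁) (h1 : ∀ ω, |G₁ ω| ≤ B) (h2m : Measurable G₂) (h2 : ∀ ω, |G₂ ω| ≤ B) {l₀ ηv : ℝ}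
    (hv : ∀ x : ℝ, |x| ≤ l₀ →
      |Var[G₂; ν₂.tilted fun ω => x * G₂ ω] - Var[G₁; ν₁.tilted fun ω => x * G₁ ω]| ≤ ηv)
    {s : ℝ} (hs : |s| ≤ l₀) :
    |(tiltedMean G₂ ν₂ s - tiltedMean G₁ ν₁ s) - (tiltedMean G₂ ν₂ 0 - tiltedMean G₁ ν₁ 0)| ≤ ηv * |s| := by
  have hl₀ : 0 ≤ l₀ := (abs_nonneg s).trans hs
  set g : ℝ → ℝ := fun x => tiltedMean G₂ ν₂ x - tiltedMean G₁ ν₁ x with hg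
  set g' : ℝ → ℝ := fun x => Var[G₂; ν₂.tilted fun ω => x * G₂ ω] - Var[G₁; ν₁.tilted fun ω => x * G₁ ω] with hg'
  have hderiv : ∀ x ∈ Set.Icc (-l₀) l₀, HasDerivWithinAt g (g' x) (Set.Icc (-l₀) l₀) x :=
    fun x _ => ((hasDerivAt_tiltedMean (ν := ν₂) h2m h2 x).sub (hasDerivAt_tiltedMean (ν := ν₁) h1m h1 x)).hasDerivWithinAt
  have hbound : ∀ x ∈ Set.Icc (-l₀) l₀, ‖g' x‖ ≤ ηv := fun x hx => by
    rw [Real.norm_eq_abs]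
    exact hv x (abs_le.mpr ⟨hx.1, hx.2⟩)
  have h0mem : (0 : ℝ) ∈ Set.Icc (-l₀) l₀ := ⟨by linarith, hl₀⟩
  have hsmem : s ∈ Set.Icc (-l₀) l₀ := ⟨(abs_le.mp hs).1, (abs_le.mp hs).2⟩
  have key := (convex_Icc (-l₀) l₀).norm_image_sub_le_of_norm_hasDerivWithin_le hderiv hbound h0mem hsmem
  rw [Real.norm_eq_abs, Real.norm_eq_abs, sub_zero] at key
  exact key

variable {ι : Type*} [DecidableEq ι] {Ω Ω' : ℕ → Type*} [∀ K, MeasurableSpace (Ω K)] [∀ K, MeasurableSpace (Ω' K)]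
  {l₀ B : ℝ} {T : ℕ → Finset ι} {Bad : ℕ → ℝ → Finset ι}
  {F : ∀ K, Ω K → ℝ} {ν : ∀ K, ι → Measure (Ω K)} {F' : ∀ K, Ω' K → ℝ} {ν' : ∀ K, ι → Measure (Ω' K)} {η₀ ηv : ℕ → ℝ}

/-- **THE VARIANCE SOCKET** (LENS control, card 3 C3-a) [folklore].  Both runs' observables measurable with `|F K|, |F′ K| ≤ B`, the
history-conditioned measures of the classes finite.  ZERO-TILT mean matching within `η₀ K` and tilted-VARIANCE matching within `ηᵥ K` on
every tilt `|s| ≤ l₀`, on every good class `τ ∈ T K \ Bad K t` for `|t| ≤ l₀`, give the residual binder of record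
`DressedMGFForm.TiltedMeanMatching l₀ T Bad F ν F′ ν′ (fun K => η₀ K + l₀·ηᵥ K)` — FTC ∕ mean value inequality on
`TiltedMeanInfluence.hasDerivAt_tiltedMean` (d∕ds tiltedMean = tilted variance).  The zero-tilt statement `η₀` is NOT implied by the
variance statement and must be supplied separately (NE1.md R23 (a)). -/
theorem tiltedMeanMatching_of_variance (hFm : ∀ K, Measurable (F K)) (hF : ∀ K ω, |F K ω| ≤ B)
    (hFm' : ∀ K, Measurable (F' K)) (hF' : ∀ K ω, |F' K ω| ≤ B) (hν : ∀ K, ∀ τ ∈ T K, IsFiniteMeasure (ν K τ))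
    (hν' : ∀ K, ∀ τ ∈ T K, IsFiniteMeasure (ν' K τ))
    (h0 : ∀ K (t : ℝ), |t| ≤ l₀ → ∀ τ ∈ T K \ Bad K t,
      |tiltedMean (F' K) (ν' K τ) 0 - tiltedMean (F K) (ν K τ) 0| ≤ η₀ K)
    (hv : ∀ K (t : ℝ), |t| ≤ l₀ → ∀ τ ∈ T K \ Bad K t, ∀ s : ℝ, |s| ≤ l₀ →
      |Var[F' K; (ν' K τ).tilted fun ω => s * F' K ω] - Var[F K; (ν K τ).tilted fun ω => s * F K ω]| ≤ ηv K) :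
    TiltedMeanMatching l₀ T Bad F ν F' ν' (fun K => η₀ K + l₀ * ηv K) := by
  intro K t ht τ hτ s hs
  have hτT : τ ∈ T K := (Finset.mem_sdiff.mp hτ).1
  haveI := hν K τ hτT
  haveI := hν' K τ hτT
  have hmv := abs_tiltedMean_sub_sub_le (ν₁ := ν K τ) (ν₂ := ν' K τ) (hFm K) (hF K) (hFm' K) (hF' K)
    (fun x hx => hv K t ht τ hτ x hx) hs
  have hηv : 0 ≤ ηv K := (abs_nonneg _).trans (hv K t ht τ hτ 0 (by simpa using (abs_nonneg t).trans ht))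
  set d₀ := tiltedMean (F' K) (ν' K τ) 0 - tiltedMean (F K) (ν K τ) 0 with hd₀
  set dₛ := tiltedMean (F' K) (ν' K τ) s - tiltedMean (F K) (ν K τ) s with hdₛ
  calc |dₛ| = |d₀ + (dₛ - d₀)| := by rw [add_sub_cancel]
    _ ≤ |d₀| + |dₛ - d₀| := abs_add_le _ _
    _ ≤ η₀ K + ηv K * |s| := add_le_add (h0 K t ht τ hτ) hmv
    _ ≤ η₀ K + l₀ * ηv K := by
        have h := mul_le_mul_of_nonneg_left hs hηv
        rw [mul_comm l₀]
        linarith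

/-- **THE SOCKET, KEYED ON THE MGF FORMS** [folklore]: with both runs' dressed term totals in `DressedMGFForm.MGFForm` (which carries the
measurability, the bound `B` and the finiteness of the class measures), zero-tilt mean matching `η₀` + tilted-variance matching `ηᵥ` on the
tilt window ⇒ `TiltedMeanMatching l₀ T Bad F ν F′ ν′ (fun K => η₀ K + l₀·ηᵥ K)` — ready for `DressedMGFForm.core_of_mgfForm` ∕
`hybridNE7_of_mgfForm`. -/
theorem tiltedMeanMatching_of_variance_of_mgfForm {P Q : ℕ → ℝ → ι → ℝ} (hP : MGFForm B T F ν P) (hQ : MGFForm B T F' ν' Q)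
    (h0 : ∀ K (t : ℝ), |t| ≤ l₀ → ∀ τ ∈ T K \ Bad K t,
      |tiltedMean (F' K) (ν' K τ) 0 - tiltedMean (F K) (ν K τ) 0| ≤ η₀ K)
    (hv : ∀ K (t : ℝ), |t| ≤ l₀ → ∀ τ ∈ T K \ Bad K t, ∀ s : ℝ, |s| ≤ l₀ →
      |Var[F' K; (ν' K τ).tilted fun ω => s * F' K ω] - Var[F K; (ν K τ).tilted fun ω => s * F K ω]| ≤ ηv K) :
    TiltedMeanMatching l₀ T Bad F ν F' ν' (fun K => η₀ K + l₀ * ηv K) :=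
  tiltedMeanMatching_of_variance hP.meas hP.bound hQ.meas hQ.bound hP.finite hQ.finite h0 hv

end Socket

/-! ## §2 The reverse martingale along an antitone family of σ-algebras: orthogonal increments, telescoping energies -/

section ReverseMartingale

variable {Ω : Type*} {mΩ : MeasurableSpace Ω} {μ : Measure Ω} [IsFiniteMeasure μ]

/-- **ORTHOGONALITY OF ONE INCREMENT** [folklore].  For sub-σ-algebras `m₁ ≤ m₂ ≤ mΩ` and `Φ ∈ L²(μ)`:
`∫ μ[Φ|m₂]·μ[Φ|m₁] dμ = ∫ (μ[Φ|m₁])² dμ` — tower property (`condExp_condExp_of_le`) and pull-out of the `m₁`-measurable factor. -/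
theorem integral_condExp_mul_condExp_of_le {m₁ m₂ : MeasurableSpace Ω} (hm₁₂ : m₁ ≤ m₂) (hm₂ : m₂ ≤ mΩ) {Φ : Ω → ℝ}
    (hΦ : MemLp Φ 2 μ) :
    ∫ ω, (μ[Φ|m₂]) ω * (μ[Φ|m₁]) ω ∂μ = ∫ ω, (μ[Φ|m₁]) ω ^ 2 ∂μ := by
  have hm₁ : m₁ ≤ mΩ := hm₁₂.trans hm₂
  have h2 : MemLp (μ[Φ|m₂]) 2 μ := hΦ.condExp one_le_two
  have h1 : MemLp (μ[Φ|m₁]) 2 μ := hΦ.condExp one_le_two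
  have hg : StronglyMeasurable[m₁] (μ[Φ|m₁]) := stronglyMeasurable_condExp
  have hint : Integrable (μ[Φ|m₁] * μ[Φ|m₂]) μ := h1.integrable_mul h2
  have htower : μ[μ[Φ|m₂]|m₁] =ᵐ[μ] μ[Φ|m₁] := condExp_condExp_of_le hm₁₂ hm₂
  have hpull : μ[μ[Φ|m₁] * μ[Φ|m₂]|m₁] =ᵐ[μ] μ[Φ|m₁] * μ[μ[Φ|m₂]|m₁] :=
    condExp_mul_of_stronglyMeasurable_left hg hint (h2.integrable one_le_two)
  calc ∫ ω, (μ[Φ|m₂]) ω * (μ[Φ|m₁]) ω ∂μ = ∫ ω, (μ[Φ|m₁] * μ[Φ|m₂]) ω ∂μ :=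
        integral_congr_ae (ae_of_all _ fun ω => by rw [Pi.mul_apply, mul_comm])
    _ = ∫ ω, (μ[μ[Φ|m₁] * μ[Φ|m₂]|m₁]) ω ∂μ := (integral_condExp hm₁).symm
    _ = ∫ ω, (μ[Φ|m₁]) ω * (μ[Φ|m₁]) ω ∂μ := by
        refine integral_congr_ae ?_
        filter_upwards [hpull, htower] with ω hω hω'
        rw [hω, Pi.mul_apply, hω']
    _ = ∫ ω, (μ[Φ|m₁]) ω ^ 2 ∂μ := by congr 1; funext ω; ring

/-- **ONE STEP OF THE ENERGY IDENTITY** [folklore]: for `m₁ ≤ m₂ ≤ mΩ` and `Φ ∈ L²(μ)`,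
`∫ (μ[Φ|m₂] − μ[Φ|m₁])² dμ = ∫ (μ[Φ|m₂])² dμ − ∫ (μ[Φ|m₁])² dμ` (Pythagoras for the orthogonal increment). -/
theorem integral_sq_condExp_sub_condExp_of_le {m₁ m₂ : MeasurableSpace Ω} (hm₁₂ : m₁ ≤ m₂) (hm₂ : m₂ ≤ mΩ) {Φ : Ω → ℝ}
    (hΦ : MemLp Φ 2 μ) :
    ∫ ω, ((μ[Φ|m₂]) ω - (μ[Φ|m₁]) ω) ^ 2 ∂μ = (∫ ω, (μ[Φ|m₂]) ω ^ 2 ∂μ) - ∫ ω, (μ[Φ|m₁]) ω ^ 2 ∂μ := by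
  have h2 : MemLp (μ[Φ|m₂]) 2 μ := hΦ.condExp one_le_two
  have h1 : MemLp (μ[Φ|m₁]) 2 μ := hΦ.condExp one_le_two
  have hi2 : Integrable (fun ω => (μ[Φ|m₂]) ω ^ 2) μ := h2.integrable_sq
  have hi1 : Integrable (fun ω => (μ[Φ|m₁]) ω ^ 2) μ := h1.integrable_sq
  have hi21 : Integrable (fun ω => (μ[Φ|m₂]) ω * (μ[Φ|m₁]) ω) μ := h2.integrable_mul h1
  have horth := integral_condExp_mul_condExp_of_le (μ := μ) hm₁₂ hm₂ hΦ
  have hsplit : (fun ω => ((μ[Φ|m₂]) ω - (μ[Φ|m₁]) ω) ^ 2)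
      = fun ω => ((μ[Φ|m₂]) ω ^ 2 - 2 * ((μ[Φ|m₂]) ω * (μ[Φ|m₁]) ω)) + (μ[Φ|m₁]) ω ^ 2 := by
    funext ω; ring
  have e1 : ∫ ω, ((μ[Φ|m₂]) ω ^ 2 - 2 * ((μ[Φ|m₂]) ω * (μ[Φ|m₁]) ω) + (μ[Φ|m₁]) ω ^ 2) ∂μ
      = (∫ ω, ((μ[Φ|m₂]) ω ^ 2 - 2 * ((μ[Φ|m₂]) ω * (μ[Φ|m₁]) ω)) ∂μ) + ∫ ω, (μ[Φ|m₁]) ω ^ 2 ∂μ :=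
    integral_add (hi2.sub (hi21.const_mul 2)) hi1
  have e2 : ∫ ω, ((μ[Φ|m₂]) ω ^ 2 - 2 * ((μ[Φ|m₂]) ω * (μ[Φ|m₁]) ω)) ∂μ
      = (∫ ω, (μ[Φ|m₂]) ω ^ 2 ∂μ) - ∫ ω, 2 * ((μ[Φ|m₂]) ω * (μ[Φ|m₁]) ω) ∂μ := integral_sub hi2 (hi21.const_mul 2)
  have e3 : ∫ ω, 2 * ((μ[Φ|m₂]) ω * (μ[Φ|m₁]) ω) ∂μ = 2 * ∫ ω, (μ[Φ|m₂]) ω * (μ[Φ|m₁]) ω ∂μ := integral_const_mul _ _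
  rw [hsplit, e1, e2, e3, horth]
  ring

/-- **ENERGY IDENTITY FOR THE REVERSE MARTINGALE `k ↦ μ[Φ | 𝒢 k]` ALONG AN ANTITONE FAMILY OF σ-ALGEBRAS** (LENS control, card 2 C2-a)
[folklore].  `μ` finite, `𝒢 : ℕ → MeasurableSpace Ω` antitone with `𝒢 k ≤ mΩ`, `Φ ∈ L²(μ)`: the increments are orthogonal and their energies
telescope, `Σ_{k<K} ∫(μ[Φ|𝒢 k] − μ[Φ|𝒢 (k+1)])² dμ = ∫(μ[Φ|𝒢 0])² dμ − ∫(μ[Φ|𝒢 K])² dμ` — K-uniform and estimate-free.  Read with the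
history-extended RG chain's «present-and-future» σ-algebras: the ANOVA of the class variance along the scales (card 3 (ii), `Φ` = the loop
observable) and the energy bookkeeping of the dressed weight `E[e^{tF₀} | 𝒢 k]` (card 2 (iii)). -/
theorem energy_identity_antitone (𝒢 : ℕ → MeasurableSpace Ω) (h𝒢 : Antitone 𝒢) (hle : ∀ k, 𝒢 k ≤ mΩ) {Φ : Ω → ℝ}
    (hΦ : MemLp Φ 2 μ) (K : ℕ) :
    ∑ k ∈ range K, ∫ ω, ((μ[Φ|𝒢 k]) ω - (μ[Φ|𝒢 (k + 1)]) ω) ^ 2 ∂μ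
      = (∫ ω, ((μ[Φ|𝒢 0]) ω) ^ 2 ∂μ) - ∫ ω, ((μ[Φ|𝒢 K]) ω) ^ 2 ∂μ := by
  have hstep : ∀ k, ∫ ω, ((μ[Φ|𝒢 k]) ω - (μ[Φ|𝒢 (k + 1)]) ω) ^ 2 ∂μ
      = (∫ ω, (μ[Φ|𝒢 k]) ω ^ 2 ∂μ) - ∫ ω, (μ[Φ|𝒢 (k + 1)]) ω ^ 2 ∂μ :=
    fun k => integral_sq_condExp_sub_condExp_of_le (μ := μ) (h𝒢 (Nat.le_succ k)) (hle k) hΦ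
  simp_rw [hstep]
  exact sum_range_sub' (fun k => ∫ ω, (μ[Φ|𝒢 k]) ω ^ 2 ∂μ) K

/-- The energies of the increments are summable against the initial energy: `Σ_{k<K} ∫(μ[Φ|𝒢 k] − μ[Φ|𝒢 (k+1)])² ≤ ∫(μ[Φ|𝒢 0])²`,
uniformly in `K` [folklore]. -/
theorem sum_integral_sq_increment_le (𝒢 : ℕ → MeasurableSpace Ω) (h𝒢 : Antitone 𝒢) (hle : ∀ k, 𝒢 k ≤ mΩ) {Φ : Ω → ℝ}
    (hΦ : MemLp Φ 2 μ) (K : ℕ) :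
    ∑ k ∈ range K, ∫ ω, ((μ[Φ|𝒢 k]) ω - (μ[Φ|𝒢 (k + 1)]) ω) ^ 2 ∂μ ≤ ∫ ω, ((μ[Φ|𝒢 0]) ω) ^ 2 ∂μ := by
  rw [energy_identity_antitone 𝒢 h𝒢 hle hΦ K]
  have h : 0 ≤ ∫ ω, ((μ[Φ|𝒢 K]) ω) ^ 2 ∂μ := integral_nonneg fun ω => sq_nonneg _
  linarith

/-- **POLARISED ENERGY BOUND** (LENS control, card 2 C2-c) [folklore].  Two reverse martingales along the same antitone family (the
observable `F` and the dressed weight `Φ`, both in `L²(μ)`): the total increment–increment interaction is bounded by half the sum of the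
two initial energies, `Σ_{k<K} |∫ ΔM_k·ΔN_k dμ| ≤ (∫(μ[F|𝒢 0])² + ∫(μ[Φ|𝒢 0])²)∕2` — `2|xy| ≤ x² + y²` under the integral, then §2's
energy identity for each martingale.  K-uniform, estimate-free; annealed (no rate). -/
theorem sum_abs_increment_cov_le (𝒢 : ℕ → MeasurableSpace Ω) (h𝒢 : Antitone 𝒢) (hle : ∀ k, 𝒢 k ≤ mΩ) {F Φ : Ω → ℝ}
    (hF : MemLp F 2 μ) (hΦ : MemLp Φ 2 μ) (K : ℕ) :
    ∑ k ∈ range K, |∫ ω, ((μ[F|𝒢 k]) ω - (μ[F|𝒢 (k + 1)]) ω) * ((μ[Φ|𝒢 k]) ω - (μ[Φ|𝒢 (k + 1)]) ω) ∂μ|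
      ≤ ((∫ ω, ((μ[F|𝒢 0]) ω) ^ 2 ∂μ) + ∫ ω, ((μ[Φ|𝒢 0]) ω) ^ 2 ∂μ) / 2 := by
  -- per step: |∫ ΔM ΔN| ≤ (∫ ΔM² + ∫ ΔN²)/2
  have hstep : ∀ k, |∫ ω, ((μ[F|𝒢 k]) ω - (μ[F|𝒢 (k + 1)]) ω) * ((μ[Φ|𝒢 k]) ω - (μ[Φ|𝒢 (k + 1)]) ω) ∂μ|
      ≤ ((∫ ω, ((μ[F|𝒢 k]) ω - (μ[F|𝒢 (k + 1)]) ω) ^ 2 ∂μ)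
          + ∫ ω, ((μ[Φ|𝒢 k]) ω - (μ[Φ|𝒢 (k + 1)]) ω) ^ 2 ∂μ) / 2 := by
    intro k
    have hM : MemLp (μ[F|𝒢 k] - μ[F|𝒢 (k + 1)]) 2 μ := (hF.condExp one_le_two).sub (hF.condExp one_le_two)
    have hN : MemLp (μ[Φ|𝒢 k] - μ[Φ|𝒢 (k + 1)]) 2 μ := (hΦ.condExp one_le_two).sub (hΦ.condExp one_le_two)
    have hiM : Integrable (fun ω => ((μ[F|𝒢 k]) ω - (μ[F|𝒢 (k + 1)]) ω) ^ 2) μ := hM.integrable_sq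
    have hiN : Integrable (fun ω => ((μ[Φ|𝒢 k]) ω - (μ[Φ|𝒢 (k + 1)]) ω) ^ 2) μ := hN.integrable_sq
    refine (abs_integral_le_integral_abs).trans ?_
    rw [← integral_add hiM hiN, ← integral_div]
    refine integral_mono_of_nonneg (ae_of_all _ fun ω => abs_nonneg _) ((hiM.add hiN).div_const 2)
      (ae_of_all _ fun ω => ?_)
    have h2 := two_mul_le_add_sq (|(μ[F|𝒢 k]) ω - (μ[F|𝒢 (k + 1)]) ω|) (|(μ[Φ|𝒢 k]) ω - (μ[Φ|𝒢 (k + 1)]) ω|)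
    rw [sq_abs, sq_abs, mul_assoc, ← abs_mul] at h2
    dsimp only
    linarith
  have hsumF := sum_integral_sq_increment_le (μ := μ) 𝒢 h𝒢 hle hF K
  have hsumΦ := sum_integral_sq_increment_le (μ := μ) 𝒢 h𝒢 hle hΦ K
  calc ∑ k ∈ range K, |∫ ω, ((μ[F|𝒢 k]) ω - (μ[F|𝒢 (k + 1)]) ω) * ((μ[Φ|𝒢 k]) ω - (μ[Φ|𝒢 (k + 1)]) ω) ∂μ|
      ≤ ∑ k ∈ range K, ((∫ ω, ((μ[F|𝒢 k]) ω - (μ[F|𝒢 (k + 1)]) ω) ^ 2 ∂μ)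
          + ∫ ω, ((μ[Φ|𝒢 k]) ω - (μ[Φ|𝒢 (k + 1)]) ω) ^ 2 ∂μ) / 2 := sum_le_sum fun k _ => hstep k
    _ = ((∑ k ∈ range K, ∫ ω, ((μ[F|𝒢 k]) ω - (μ[F|𝒢 (k + 1)]) ω) ^ 2 ∂μ)
          + ∑ k ∈ range K, ∫ ω, ((μ[Φ|𝒢 k]) ω - (μ[Φ|𝒢 (k + 1)]) ω) ^ 2 ∂μ) / 2 := by
        rw [← sum_add_distrib, sum_div]
    _ ≤ ((∫ ω, ((μ[F|𝒢 0]) ω) ^ 2 ∂μ) + ∫ ω, ((μ[Φ|𝒢 0]) ω) ^ 2 ∂μ) / 2 := by linarith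

end ReverseMartingale

/-! ## §3 The Jensen gap of the logarithm under conditional expectation: second order in the increment -/

section LogGap

/-- The function `y ↦ log y + y²∕(2a²)` is CONVEX on `[a, b]` for `0 < a` [folklore]: its derivative `y⁻¹ + y∕a²` is monotone there
(`y⁻¹ − z⁻¹ = (z − y)∕(yz) ≤ (z − y)∕a²` for `a ≤ y ≤ z`). -/
theorem convexOn_log_add_sq {a b : ℝ} (ha : 0 < a) :
    ConvexOn ℝ (Set.Icc a b) (fun y => Real.log y + y ^ 2 / (2 * a ^ 2)) := by
  have ha2 : 0 < a ^ 2 := pow_pos ha 2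
  have hderiv : ∀ y, 0 < y → HasDerivAt (fun y => Real.log y + y ^ 2 / (2 * a ^ 2)) (y⁻¹ + y / a ^ 2) y := by
    intro y hy
    have h1 := Real.hasDerivAt_log hy.ne'
    have h2 : HasDerivAt (fun y : ℝ => y ^ 2 / (2 * a ^ 2)) (y / a ^ 2) y := by
      have h := (hasDerivAt_pow 2 y).div_const (2 * a ^ 2)
      have he : (↑(2 : ℕ) * y ^ (2 - 1)) / (2 * a ^ 2) = y / a ^ 2 := by
        rw [Nat.cast_ofNat, show (2 : ℕ) - 1 = 1 from rfl, pow_one]; field_simp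
      exact he ▸ h
    exact h1.add h2
  refine MonotoneOn.convexOn_of_deriv (convex_Icc a b) ?_ ?_ ?_
  · -- continuity on [a, b] (every point is positive)
    intro y hy
    exact (hderiv y (ha.trans_le hy.1)).continuousAt.continuousWithinAt
  · intro y hy
    have hy' : 0 < y := ha.trans_le (interior_subset hy).1
    exact (hderiv y hy').differentiableAt.differentiableWithinAt
  · intro y hy z hz hyz
    have hya : a ≤ y := (interior_subset hy).1
    have hza : a ≤ z := (interior_subset hz).1
    have hy' : 0 < y := ha.trans_le hya
    have hz' : 0 < z := ha.trans_le hza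
    rw [(hderiv y hy').deriv, (hderiv z hz').deriv]
    -- y⁻¹ + y/a² ≤ z⁻¹ + z/a²  ⟸  (z − y)/(yz) ≤ (z − y)/a²  ⟸  a² ≤ yz
    have hyz' : a ^ 2 ≤ y * z := by rw [pow_two]; exact mul_le_mul hya hza ha.le hy'.le
    have h1 : y⁻¹ - z⁻¹ = (z - y) / (y * z) := by field_simp
    have h2 : (z - y) / (y * z) ≤ (z - y) / a ^ 2 :=
      div_le_div_of_nonneg_left (by linarith) ha2 hyz'
    have h3 : z / a ^ 2 - y / a ^ 2 = (z - y) / a ^ 2 := by ring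
    linarith

variable {Ω : Type*} {mΩ : MeasurableSpace Ω} {μ : Measure Ω} [IsFiniteMeasure μ]

/-- The conditional variance identity `μ[(N − μ[N|m])² | m] = μ[N² | m] − (μ[N|m])²` a.e., for bounded measurable `N` [folklore]
(pull-out of the `m`-measurable factor `μ[N|m]`). -/
theorem condExp_sq_sub_condExp {m : MeasurableSpace Ω} (hm : m ≤ mΩ) {N : Ω → ℝ} {a b : ℝ} (hNm : Measurable[mΩ] N)
    (hN : ∀ ω, N ω ∈ Set.Icc a b) :
    μ[fun ω => (N ω - (μ[N|m]) ω) ^ 2|m] =ᵐ[μ] fun ω => (μ[fun ω => N ω ^ 2|m]) ω - (μ[N|m]) ω ^ 2 := by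
  -- `N` and `μ[N|m]` are bounded, hence everything is integrable
  have hNbd : ∀ ω, |N ω| ≤ max |a| |b| := fun ω => abs_le_max_abs_abs (hN ω).1 (hN ω).2
  have hNi : Integrable N μ := (memLp_top_of_bound (μ := μ) hNm.aestronglyMeasurable (max |a| |b|)
    (ae_of_all _ fun ω => by rw [Real.norm_eq_abs]; exact hNbd ω)).integrable le_top
  have hcbd : ∀ᵐ ω ∂μ, ‖(μ[N|m]) ω‖ ≤ max |a| |b| :=
    ae_bdd_norm_condExp_of_ae_bdd_norm (ae_of_all _ fun ω => by rw [Real.norm_eq_abs]; exact hNbd ω)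
  have hcm : StronglyMeasurable[m] (μ[N|m]) := stronglyMeasurable_condExp
  have hci : Integrable (μ[N|m]) μ := integrable_condExp
  have hN2i : Integrable (fun ω => N ω ^ 2) μ := by
    refine (hNi.bdd_mul (c := max |a| |b|) hNm.aestronglyMeasurable (ae_of_all _ fun ω => ?_)).congr ?_
    · rw [Real.norm_eq_abs]; exact hNbd ω
    · exact ae_of_all _ fun ω => by simp [pow_two]
  have hcNi : Integrable (μ[N|m] * N) μ :=
    hNi.bdd_mul (hcm.mono hm).aestronglyMeasurable hcbd
  have hcci : Integrable (μ[N|m] * μ[N|m]) μ :=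
    hci.bdd_mul (hcm.mono hm).aestronglyMeasurable hcbd
  -- pull-outs
  have hp1 : μ[μ[N|m] * N|m] =ᵐ[μ] μ[N|m] * μ[N|m] := condExp_mul_of_stronglyMeasurable_left hcm hcNi hNi
  have hp2 : μ[μ[N|m] * μ[N|m]|m] = μ[N|m] * μ[N|m] :=
    condExp_of_stronglyMeasurable hm (hcm.mul hcm) hcci
  -- expand the square
  have hsplit : (fun ω => (N ω - (μ[N|m]) ω) ^ 2)
      = (fun ω => N ω ^ 2) - (2 : ℝ) • (μ[N|m] * N) + μ[N|m] * μ[N|m] := by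
    funext ω; simp only [Pi.add_apply, Pi.sub_apply, Pi.smul_apply, Pi.mul_apply, smul_eq_mul]; ring
  rw [hsplit]
  have hadd := condExp_add ((hN2i.sub (hcNi.smul (2 : ℝ)))) hcci m (μ := μ)
  have hsub := condExp_sub hN2i (hcNi.smul (2 : ℝ)) m (μ := μ)
  have hsm := condExp_smul (2 : ℝ) (μ[N|m] * N) m (μ := μ)
  filter_upwards [hadd, hsub, hsm, hp1] with ω h1 h2 h3 h4
  rw [h1, Pi.add_apply, h2, Pi.sub_apply, h3, Pi.smul_apply, h4, hp2, Pi.mul_apply, smul_eq_mul]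
  ring

/-- **JENSEN GAP OF THE LOGARITHM ≤ CONDITIONAL VARIANCE ∕ (2a²)** (LENS control, card 2 C2-b) [folklore].  `μ` a finite measure (a probability law in the application), `m ≤ mΩ`
a sub-σ-algebra, `N` measurable with values in `[a, b]`, `0 < a`.  Then a.e.
`log(μ[N|m]) − μ[log N | m] ≤ μ[(N − μ[N|m])² | m] ∕ (2a²)`: conditional Jensen (Mathlib `ConvexOn.map_condExp_le`) for the convex function
`y ↦ log y + y²∕(2a²)` on `[a, b]` (`convexOn_log_add_sq`), read through `condExp_sq_sub_condExp`.  Pathwise: the born term of one step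
(`log E[N|m] − E[log N|m]` for the positive normalised weight `N ∈ [e^{−l₀B}, e^{l₀B}]`) is SECOND order in the martingale increment. -/
theorem condExp_log_gap_le {m : MeasurableSpace Ω} (hm : m ≤ mΩ) {N : Ω → ℝ} {a b : ℝ} (ha : 0 < a) (hNm : Measurable[mΩ] N)
    (hN : ∀ ω, N ω ∈ Set.Icc a b) :
    ∀ᵐ ω ∂μ, Real.log ((μ[N|m]) ω) - (μ[fun ω => Real.log (N ω)|m]) ω
      ≤ (μ[fun ω => (N ω - (μ[N|m]) ω) ^ 2|m]) ω / (2 * a ^ 2) := by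
  set ψ : ℝ → ℝ := fun y => Real.log y + y ^ 2 / (2 * a ^ 2) with hψ
  have ha2 : 0 < 2 * a ^ 2 := by positivity
  -- integrability: everything is bounded on `[a, b]`
  have hNbd : ∀ ω, |N ω| ≤ max |a| |b| := fun ω => abs_le_max_abs_abs (hN ω).1 (hN ω).2
  have hNi : Integrable N μ := (memLp_top_of_bound (μ := μ) hNm.aestronglyMeasurable (max |a| |b|)
    (ae_of_all _ fun ω => by rw [Real.norm_eq_abs]; exact hNbd ω)).integrable le_top
  have hcont : ContinuousOn ψ (Set.Icc a b) := fun y hy =>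
    ((Real.continuousAt_log (ha.trans_le hy.1).ne').add (by fun_prop)).continuousWithinAt
  obtain ⟨C, hC⟩ := (isCompact_Icc (a := a) (b := b)).exists_bound_of_continuousOn hcont
  have hψN : Integrable (ψ ∘ N) μ := by
    refine (memLp_top_of_bound ((hNm.log.add (by fun_prop)).aestronglyMeasurable) C
      (ae_of_all _ fun ω => hC (N ω) (hN ω))).integrable le_top
  have hlogN : Integrable (fun ω => Real.log (N ω)) μ := by
    have hb : ∀ ω, |Real.log (N ω)| ≤ max |Real.log a| |Real.log b| := fun ω =>
      abs_le_max_abs_abs (Real.log_le_log ha (hN ω).1) (Real.log_le_log (ha.trans_le (hN ω).1) (hN ω).2)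
    exact (memLp_top_of_bound hNm.log.aestronglyMeasurable _ (ae_of_all _ fun ω => by
      rw [Real.norm_eq_abs]; exact hb ω)).integrable le_top
  have hN2i : Integrable (fun ω => N ω ^ 2) μ := by
    refine (hNi.bdd_mul (c := max |a| |b|) hNm.aestronglyMeasurable (ae_of_all _ fun ω => ?_)).congr ?_
    · rw [Real.norm_eq_abs]; exact hNbd ω
    · exact ae_of_all _ fun ω => by simp [pow_two]
  -- conditional Jensen for the convex `ψ` on the closed convex `[a, b]`
  have hJ := (convexOn_log_add_sq (b := b) ha).map_condExp_le (μ := μ) (f := N) hm hcont.lowerSemicontinuousOn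
    (ae_of_all _ hN) isClosed_Icc hNi hψN
  -- split `μ[ψ ∘ N | m]` and rewrite the conditional variance
  have hsplit : ψ ∘ N = (fun ω => Real.log (N ω)) + (2 * a ^ 2)⁻¹ • fun ω => N ω ^ 2 := by
    funext ω; simp only [hψ, Function.comp_apply, Pi.add_apply, Pi.smul_apply, smul_eq_mul]; ring
  have hadd := condExp_add hlogN (hN2i.smul ((2 * a ^ 2)⁻¹)) m (μ := μ)
  have hsm := condExp_smul ((2 * a ^ 2)⁻¹) (fun ω => N ω ^ 2) m (μ := μ)
  have hvar := condExp_sq_sub_condExp (μ := μ) hm hNm hN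
  have ec : ∀ x : ℝ, x / (2 * a ^ 2) = x * (2 * a ^ 2)⁻¹ := fun x => div_eq_mul_inv x _
  filter_upwards [hJ, hadd, hsm, hvar] with ω hJω h1 h2 h3
  rw [hsplit, h1, Pi.add_apply, h2, Pi.smul_apply, smul_eq_mul] at hJω
  simp only [Function.comp_apply, ec] at hJω
  rw [h3, ec]
  set c := (2 * a ^ 2)⁻¹ with hc
  linarith

end LogGap

end YMDAG.N14.VarianceSocket

end
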